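import Literature.MathematicalPhysics.QuantumLattice.HubbardModel
import Literature.MathematicalPhysics.QuantumLattice.HubbardWave0LiebProofs
import Literature.MathematicalPhysics.QuantumFieldTheory.ConstructiveQFTWave0
import Literature.Barriers.QuantumFields.NoContinuousLatticeTopologicalCharge
import HarnessLib

/-!
# The Hubbard model on the torus `(ℤ/L)²` in a lattice `U(1)` gauge field (Peierls phases)

Topic `Literature/MathematicalPhysics/QuantumLattice` (family `hubbard`). Requested by the route
`ChernVortexResponse` of `HubbardSuperconductivity` (definition item `defn-magneticHubbardTorus`),
whose statements inline the operator defined here.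

## Contents

* `magneticHubbardTorus L A t U` — the Hubbard Hamiltonian on the fermionic torus
  `FermionTorus 2 L` minimally coupled, through Peierls phase factors, to a lattice `U(1)` gauge
  field `A : GaugeConfig 2 L Circle` (one phase `A (x, i) ∈ U(1)` on every positively oriented
  edge `(x, x + eᵢ)` of `(ℤ/L)²`, the tree's `Literature.MathematicalPhysics.QuantumFieldTheory.GaugeConfig`):
  `H_A(t, U) = -t Σ_{x, i, σ} [A(x,i) c†_{x+eᵢ,σ} c_{x,σ} + conj(A(x,i)) c†_{x,σ} c_{x+eᵢ,σ}]
  + U Σ_y n_{y↑} n_{y↓}` (Peierls substitution `t ↦ t e^{iφ(x,y)}`, `φ(x,y) = -φ(y,x)`: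
  Lieb, PRL 73 (1994) 2158, eq. (1)–(2); Assaad, PRB 65 (2002) 115104, §III.B).
* `fluxResponse L U N` — the one-flux-quantum response `V_L(U, N) = E_L^{flux}(N, S^z = 0) −
  E_L^{0}(N, S^z = 0)`: difference of the sector energies `Matrix.minEnergyOn · (szSector N 0)` of
  `magneticHubbardTorus L (uniformFlux L) 1 U` (every plaquette carries the flux `2π/L²`, total
  flux one quantum, `u1Charge_uniformFlux`; Assaad's `B L²/Φ₀ = 1`) and of `hubbardTorus 2 L 1 U`.
* `phaseGauge g` — the unitary site-phase (gauge) transformation `|s⟩ ↦ (∏_{(x,σ) ∈ s} g x) |s⟩`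
  of Fock space, the unitary cousin of Koma–Tasaki's `siteGauge` (real exponents).
* API proved here: the `t = 1` unfolding `magneticHubbardTorus_one` (literally the term inlined
  in the route file, so its statements restate over the named operator by `rw`), `fluxResponse_eq`;
  hermiticity (`magneticHubbardTorus_isHermitian`); conservation of `N` and `S^z`
  (`magneticHubbardTorus_commute_totalNumber`, `magneticHubbardTorus_commute_spinZ`, via the
  sector bookkeeping `PreservesSectors` of `HubbardLiebConfig`).
* In the companion files: the trivial field gives back `hubbardTorus 2 L t U` for `3 ≤ L`
  (`MagneticHubbardTorusTrivialField.lean`, `magneticHubbardTorus_one_eq_hubbardTorus`; false for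
  `L = 2`, where the simple torus graph has each bond once but the edge sum has it twice); gauge
  covariance `H_{A^g} = W_gᴴ H_A W_g` and the resulting gauge invariance of the sector energies
  (`MagneticHubbardTorusGauge.lean`, `magneticHubbardTorus_gaugeTransform`,
  `minEnergyOn_szSector_gaugeTransform`).

## Conventions

* Edges, sites, shifts and gauge transformations are those of the lattice-gauge glue
  (`Site 2 L = Fin 2 → ZMod L`, `Site.shift x i = x + eᵢ`,
  `gaugeTransform g A (x, i) = g x * A (x, i) * (g (x + eᵢ))⁻¹`); fermion sites are transported
  along `FermionTorus.ofTorusSite : (Fin 2 → ZMod L) → FermionTorus 2 L`.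
* The phase `A (x, i)` multiplies the hop `x → x + eᵢ` (`c†_{x+eᵢ} c_x`), its conjugate the
  reverse hop, exactly as inlined in the route file. With the tree's convention for
  `gaugeTransform` this makes `H_{gaugeTransform g A} = (phaseGauge g)ᴴ * H_A * phaseGauge g`.
* `t = 1` in `fluxResponse` (the route's normalisation).

## What is not here

The plaquette/flux bookkeeping of `uniformFlux` (`u1Plaquette_uniformFlux`, `u1Charge_uniformFlux`,
`prod_u1Plaquette`) is already in `Literature.Barriers.QuantumFields.NoContinuousLatticeTopologicalCharge`;
magnetic translations and the Hofstadter spectrum are not formalised.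

## References

* E. H. Lieb, *Flux phase of the half-filled band*, PRL 73 (1994) 2158, eqs. (1)–(2) and the
  gauge-invariance remark before eq. (1). [Lieb1994]
* F. F. Assaad, *Depleted Kondo lattices*, PRB 65 (2002) 115104 (arXiv:cond-mat/0104126), §III.B
  (Peierls factors, flux quantisation `B L²/Φ₀ = 1` on the `L × L` torus). [Assaad2002]
* T. Koma, H. Tasaki, PRL 68 (1992) 3248, eq. (5) (gauge transformations on Fock space). [KomaTasakiPRL1992]
-/

noncomputable section

namespace Literature.MathematicalPhysics.QuantumLattice

open Matrix Finset Literature.MathematicalPhysics.QuantumFieldTheory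
open scoped ComplexConjugate

variable {L : ℕ}

/-! ### The definition -/

/-- The **Hubbard Hamiltonian on the torus `(ℤ/L)²` in the lattice `U(1)` gauge field `A`**
(Peierls substitution): `H_A(t,U) = -t Σ_{x : (ℤ/L)²} Σ_{i : Fin 2} Σ_σ [A(x,i) c†_{x+eᵢ,σ} c_{x,σ}
+ conj(A(x,i)) c†_{x,σ} c_{x+eᵢ,σ}] + U Σ_y n_{y↑} n_{y↓}`, an operator on the Fock space over
`Orb (FermionTorus 2 L)`; the phases are spin independent. For `A = 1` and `L ≥ 3` this is
`hubbardTorus 2 L t U` (`magneticHubbardTorus_one_eq_hubbardTorus`).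
Lieb, PRL 73 (1994) 2158, eqs. (1)–(2) (`t_{xy} = |t_{xy}| e^{iφ(x,y)}`); Assaad, PRB 65 (2002)
115104, §III.B. [cite: Lieb1994, eqs. (1)–(2)] -/
def magneticHubbardTorus (L : ℕ) [NeZero L] (A : GaugeConfig 2 L Circle) (t U : ℝ) :
    Matrix (Finset (Orb (FermionTorus 2 L))) (Finset (Orb (FermionTorus 2 L))) ℂ :=
  -(t : ℂ) • (∑ x : Site 2 L, ∑ i : Fin 2, ∑ σ : Fin 2,
      (((A (x, i) : Circle) : ℂ) •
          (creation (orb (FermionTorus.ofTorusSite (Site.shift x i)) σ) *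
            annihilation (orb (FermionTorus.ofTorusSite x) σ)) +
        (starRingEnd ℂ) ((A (x, i) : Circle) : ℂ) •
          (creation (orb (FermionTorus.ofTorusSite x) σ) *
            annihilation (orb (FermionTorus.ofTorusSite (Site.shift x i)) σ)))) +
    (U : ℂ) • ∑ y : FermionTorus 2 L, numberOp y 0 * numberOp y 1

/-- The **one-flux-quantum response** `V_L(U, N) = E_L^{flux}(N, 0) − E_L^{0}(N, 0)`: the lowest
energy of the Hubbard torus (`t = 1`) pierced by one quantum of uniform flux
(`A = uniformFlux L`, every plaquette `exp(2πi/L²)`) in the sector `(N, S^z = 0)`, minus the same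
sector energy without field. Assaad, PRB 65 (2002) 115104, §III.B (`B L²/Φ₀ = 1`). [cite: Assaad2002, §III.B] -/
def fluxResponse (L : ℕ) [NeZero L] (U : ℝ) (N : ℕ) : ℝ :=
  (magneticHubbardTorus L (Literature.Barriers.QuantumFields.uniformFlux L) 1 U).minEnergyOn
      (szSector N 0) -
    (hubbardTorus 2 L 1 U).minEnergyOn (szSector N 0)

/-- Unfolding of `magneticHubbardTorus`. [folklore] -/
theorem magneticHubbardTorus_eq [NeZero L] (A : GaugeConfig 2 L Circle) (t U : ℝ) :
    magneticHubbardTorus L A t U =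
      -(t : ℂ) • (∑ x : Site 2 L, ∑ i : Fin 2, ∑ σ : Fin 2,
        (((A (x, i) : Circle) : ℂ) •
            (creation (orb (FermionTorus.ofTorusSite (Site.shift x i)) σ) *
              annihilation (orb (FermionTorus.ofTorusSite x) σ)) +
          (starRingEnd ℂ) ((A (x, i) : Circle) : ℂ) •
            (creation (orb (FermionTorus.ofTorusSite x) σ) *
              annihilation (orb (FermionTorus.ofTorusSite (Site.shift x i)) σ)))) +
      (U : ℂ) • ∑ y : FermionTorus 2 L, numberOp y 0 * numberOp y 1 :=
  rfl

/-- At `t = 1` the magnetic Hubbard torus is *literally* the term inlined in the route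
`ChernVortexResponse` (with `A = uniformFlux L`): `-(Σ …) + U • Σ_y n_{y↑} n_{y↓}`. [folklore] -/
theorem magneticHubbardTorus_one [NeZero L] (A : GaugeConfig 2 L Circle) (U : ℝ) :
    magneticHubbardTorus L A 1 U =
      -(∑ x : Site 2 L, ∑ i : Fin 2, ∑ σ : Fin 2,
        (((A (x, i) : Circle) : ℂ) •
            (creation (orb (FermionTorus.ofTorusSite (Site.shift x i)) σ) *
              annihilation (orb (FermionTorus.ofTorusSite x) σ)) +
          (starRingEnd ℂ) ((A (x, i) : Circle) : ℂ) •
            (creation (orb (FermionTorus.ofTorusSite x) σ) *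
              annihilation (orb (FermionTorus.ofTorusSite (Site.shift x i)) σ)))) +
      ((U : ℝ) : ℂ) • ∑ y : FermionTorus 2 L, numberOp y 0 * numberOp y 1 := by
  rw [magneticHubbardTorus, Complex.ofReal_one, neg_smul, one_smul]

/-- `fluxResponse` unfolded to the literal difference of sector energies used by the route
`ChernVortexResponse`. [folklore] -/
theorem fluxResponse_eq [NeZero L] (U : ℝ) (N : ℕ) :
    fluxResponse L U N =
      Matrix.minEnergyOn (-(∑ x : Site 2 L, ∑ i : Fin 2, ∑ σ : Fin 2,
        (((Literature.Barriers.QuantumFields.uniformFlux L (x, i) : Circle) : ℂ) •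
            (creation (orb (FermionTorus.ofTorusSite (Site.shift x i)) σ) *
              annihilation (orb (FermionTorus.ofTorusSite x) σ)) +
          (starRingEnd ℂ) ((Literature.Barriers.QuantumFields.uniformFlux L (x, i) : Circle) : ℂ) •
            (creation (orb (FermionTorus.ofTorusSite x) σ) *
              annihilation (orb (FermionTorus.ofTorusSite (Site.shift x i)) σ)))) +
        ((U : ℝ) : ℂ) • ∑ y : FermionTorus 2 L, numberOp y 0 * numberOp y 1)
        (szSector N 0) -
      Matrix.minEnergyOn (hubbardTorus 2 L 1 U) (szSector N 0) := by
  rw [fluxResponse, magneticHubbardTorus_one]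

/-! ### Hermiticity and the conservation of `N` and `S^z` -/

section Symmetries

variable {ι : Type*} [LinearOrder ι] [Fintype ι]

/-- `(c†_p c_q)ᴴ = c†_q c_p`. Bratteli–Robinson II §5.2.2. [folklore] -/
theorem conjTranspose_creation_mul_annihilation (p q : ι) :
    (creation p * annihilation q)ᴴ = creation q * annihilation p := by
  rw [conjTranspose_mul, creation_conjTranspose, annihilation_conjTranspose]

variable [NeZero L]

/-- The Peierls hopping term `Σ_{x,i,σ} [A c†_{x+eᵢ} c_x + conj(A) c†_x c_{x+eᵢ}]` is Hermitian
(each summand is `X + Xᴴ`). Lieb, PRL 73 (1994) 2158, before eq. (1) (`φ(x,y) = -φ(y,x)` for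
hermiticity). [cite: Lieb1994, eq. (1)] -/
theorem conjTranspose_magneticHopping (A : GaugeConfig 2 L Circle) :
    (∑ x : Site 2 L, ∑ i : Fin 2, ∑ σ : Fin 2,
      (((A (x, i) : Circle) : ℂ) •
          (creation (orb (FermionTorus.ofTorusSite (Site.shift x i)) σ) *
            annihilation (orb (FermionTorus.ofTorusSite x) σ)) +
        (starRingEnd ℂ) ((A (x, i) : Circle) : ℂ) •
          (creation (orb (FermionTorus.ofTorusSite x) σ) *
            annihilation (orb (FermionTorus.ofTorusSite (Site.shift x i)) σ))))ᴴ =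
    ∑ x : Site 2 L, ∑ i : Fin 2, ∑ σ : Fin 2,
      (((A (x, i) : Circle) : ℂ) •
          (creation (orb (FermionTorus.ofTorusSite (Site.shift x i)) σ) *
            annihilation (orb (FermionTorus.ofTorusSite x) σ)) +
        (starRingEnd ℂ) ((A (x, i) : Circle) : ℂ) •
          (creation (orb (FermionTorus.ofTorusSite x) σ) *
            annihilation (orb (FermionTorus.ofTorusSite (Site.shift x i)) σ))) := by
  simp only [conjTranspose_sum]
  refine Finset.sum_congr rfl fun x _ => Finset.sum_congr rfl fun i _ =>
    Finset.sum_congr rfl fun σ _ => ?_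
  rw [conjTranspose_add, conjTranspose_smul, conjTranspose_smul,
    conjTranspose_creation_mul_annihilation, conjTranspose_creation_mul_annihilation, add_comm]
  simp only [Complex.star_def, Complex.conj_conj]

/-- The on-site interaction `Σ_y n_{y↑} n_{y↓}` is Hermitian (commuting Hermitian projections).
Lieb, PRL 62 (1989) 1201, eq. (1). [folklore] -/
theorem conjTranspose_sum_numberOp_mul_numberOp {Λ : Type*} [LinearOrder Λ] [Fintype Λ] :
    (∑ y : Λ, (numberOp y 0 * numberOp y 1 : Matrix (Finset (Orb Λ)) (Finset (Orb Λ)) ℂ))ᴴ =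
      ∑ y : Λ, numberOp y 0 * numberOp y 1 := by
  rw [conjTranspose_sum]
  refine Finset.sum_congr rfl fun y _ => ?_
  rw [conjTranspose_mul, ← numberAt_orb, ← numberAt_orb, (numberAt_isHermitian _).eq,
    (numberAt_isHermitian _).eq]
  exact (numberAt_commute _ _).eq

/-- **`H_A` is Hermitian** for real `t`, `U` and unitary phases `A`. Lieb, PRL 73 (1994) 2158,
eq. (1) (`φ(x,y) = -φ(y,x)` "for hermiticity"). [cite: Lieb1994, eq. (1)] -/
theorem magneticHubbardTorus_isHermitian (A : GaugeConfig 2 L Circle) (t U : ℝ) :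
    (magneticHubbardTorus L A t U).IsHermitian := by
  rw [IsHermitian, magneticHubbardTorus, conjTranspose_add, conjTranspose_smul,
    conjTranspose_smul, conjTranspose_magneticHopping, conjTranspose_sum_numberOp_mul_numberOp]
  simp only [Complex.star_def, map_neg, Complex.conj_ofReal]

/-- `H_A` conserves the numbers of up and of down electrons: it is block diagonal in the spin
sectors `(N↑, N↓)` (spin-independent Peierls phases). Lieb, PRL 73 (1994) 2158, after eq. (1)
(`N = N↑ + N↓` conserved). [folklore] -/
theorem preservesSectors_magneticHubbardTorus (A : GaugeConfig 2 L Circle) (t U : ℝ) :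
    PreservesSectors (magneticHubbardTorus L A t U) := by
  unfold magneticHubbardTorus
  refine PreservesSectors.add (PreservesSectors.smul (PreservesSectors.sum fun x _ =>
    PreservesSectors.sum fun i _ => PreservesSectors.sum fun σ _ =>
      PreservesSectors.add (PreservesSectors.smul (LiebThm1.preservesSectors_hopping _ _ σ) _)
        (PreservesSectors.smul (LiebThm1.preservesSectors_hopping _ _ σ) _)) _)
    (PreservesSectors.smul (PreservesSectors.sum fun y _ =>
      (LiebThm1.preservesSectors_numberOp y 0).mul (LiebThm1.preservesSectors_numberOp y 1)) _)

/-- **`[H_A, N] = 0`**: the magnetic Hubbard torus conserves the particle number.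
Lieb, PRL 73 (1994) 2158, after eq. (1). [folklore] -/
theorem magneticHubbardTorus_commute_totalNumber (A : GaugeConfig 2 L Circle) (t U : ℝ) :
    Commute (magneticHubbardTorus L A t U) totalNumber := by
  rw [LiebThm1.totalNumber_eq_diagonal]
  exact (preservesSectors_magneticHubbardTorus A t U).commute_diagonal
    fun a b => ((a + b : ℕ) : ℂ)

/-- **`[H_A, S^z] = 0`**: the magnetic Hubbard torus conserves `S^z` (the Peierls phases do not
depend on the spin). Lieb, PRL 73 (1994) 2158, after eq. (1). [folklore] -/
theorem magneticHubbardTorus_commute_spinZ (A : GaugeConfig 2 L Circle) (t U : ℝ) :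
    Commute (magneticHubbardTorus L A t U) HubbardWave0.spinZ := by
  rw [LiebThm1.spinZ_eq_diagonal]
  exact (preservesSectors_magneticHubbardTorus A t U).commute_diagonal
    fun a b => (1 / 2 : ℂ) * ((a : ℂ) - (b : ℂ))

end Symmetries

/-! ### The unitary site-phase transformation (its API and the gauge covariance of `H_A` are in
`MagneticHubbardTorusGauge.lean`) -/

section Gauge

variable {Λ : Type*} [LinearOrder Λ]

/-- The **unitary site-phase (gauge) transformation** of Fock space generated by
`g : Λ → U(1)`: the diagonal matrix `|s⟩ ↦ (∏_{(x,σ) ∈ s} g x) |s⟩` in the occupation basis,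
i.e. `exp[i Σ_x θ_x (n_{x↑} + n_{x↓})]` for `g x = e^{iθ_x}` — the unitary (real-angle) case of
Koma–Tasaki's `siteGauge`. Koma–Tasaki, PRL 68 (1992) 3248, eq. (5); Lieb, PRL 73 (1994) 2158
("trivial gauge transformation `c_x ↦ e^{iθ} c_x`"). [cite: KomaTasakiPRL1992, eq. (5)] -/
def phaseGauge (g : Λ → Circle) : Matrix (Finset (Orb Λ)) (Finset (Orb Λ)) ℂ :=
  diagonal fun s => ((∏ o ∈ s, g (ofLex o).1 : Circle) : ℂ)

/-- `phaseGauge g` unfolded. [folklore] -/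
theorem phaseGauge_eq (g : Λ → Circle) :
    phaseGauge g = diagonal fun s => ((∏ o ∈ s, g (ofLex o).1 : Circle) : ℂ) := rfl

/-- The trivial phase acts as the identity. [folklore] -/
@[simp] theorem phaseGauge_one : phaseGauge (1 : Λ → Circle) = 1 := by
  simp [phaseGauge]

end Gauge

end Literature.MathematicalPhysics.QuantumLattice
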